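import Literature.Probability.RandomPlanarGeometry.ImaginaryGeometryLocalized
import Literature.Analysis.FunctionSpaces.ItoProductRuleProgressive
import Mathlib.Analysis.SpecialFunctions.Trigonometric.ArctanDeriv
import HarnessLib

/-!
# Itô's formula for `𝔥_t(z)` along the SLE(κ, ρ) point flow: the drift vanishes

Fourth file of the almost-sure form of Miller–Sheffield's Theorem 2.4 (⇒) (J. Miller,
S. Sheffield, *Imaginary geometry I*, PTRF 164 (2016), §2.3: "That `𝔥_t` evolves as a continuous
local martingale if `W_t` and `V_t^{j,q}` correspond to an SLE_κ(ρ) can be seen by applying Itô's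
formula"). With the stopped, clamped, progressive processes of `ImaginaryGeometryLocalized.lean`
(localising optional time `ρₙ`) we run the Itô calculus of the slope form
`𝔥 = -λρ/2 + (2λ/π) arctan(X/Y) + (λρ/π) arctan((X + Z')/Y) - χ A`
(`Loewner.imaginaryHarmonic_eq_arctan`) inside the tree's Itô calculus:

* `igW = X · (1/Y)` (the slope `x/y`) is an Itô process by the progressive product rule
  (`IsItoProcess.mul_timeIntegral_of_progressive`), drift `X·𝟙2/(YQ) + (1/Y)·𝟙(2X/Q - ρJ)`,
  diffusion coefficient `𝟙(-√κ)/Y`;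
* `igR = X + Z'` has NO stochastic part (`-√κ B^{ρₙ} + √κ B^{ρₙ} = 0`): an Itô process with drift
  `𝟙(2X/Q - ρJ) + 𝟙(ρ+2)J` and zero diffusion coefficient; hence `igV = (X + Z')·(1/Y)` is an Itô
  process of finite variation (product rule with `σ = 0`);
* Itô's formula (`ito_formula_itoProcess_ae_holds`) for `arctan` along `igW` and along `igV`;
* **the drift of `𝔥` vanishes** (`itoDrift_arctan_slope_eq`, `drift_arctan_ratio_eq`,
  `igHDrift_eq_zero_of_le`): at times `s ≤ ρₙ` with `J_s Z'_s = 1` the total drift is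
  `XY/Q² · ((2λ/π)(4-κ) - 4χ) = 0` by `2πχ = (4-κ)λ` (`two_pi_mul_igChi`); the exceptional times
  (`Z'_s = 0`, collisions of `W` with the force point) are Lebesgue-null on good paths;
* `ae_igH_eq` — **almost surely, for all `t`,
  `𝔥^{(n)}_t = 𝔥^{(n)}_0 + (2λ/π) K_t`** with `K = ∫ 𝟙(-√κ)(1/Y)·arctan'(w) dB` a square-integrable
  martingale, where `𝔥^{(n)} = igH` is the slope form evaluated along the localised processes
  (equal to `𝔥_{t∧ρₙ}(z)` on good paths, next file).

No named fact is introduced.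

## References

* J. Miller, S. Sheffield, *Imaginary geometry I*, PTRF 164 (2016), §2.3 Thm. 2.4 (proof),
  Thm. 1.1 (`χ = 2/√κ - √κ/2`), Fig. 1.9 (`λ = π/√κ`).
* D. Revuz, M. Yor, *Continuous Martingales and Brownian Motion* (1999), Ch. IV, Prop. (3.1),
  Thm (3.3).
-/

noncomputable section

open Set Filter MeasureTheory Complex
open _root_.Topology
open scoped NNReal Real
open Literature.Analysis.FunctionSpaces Literature.Probability.Process

namespace Literature.Probability.RandomPlanarGeometry

namespace SLEKappaRho

/-! ### Calculus of `arctan` -/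

/-- `arctan' v = 1/(1+v²)` in `deriv` form. [folklore] -/
theorem deriv_arctan_apply (v : ℝ) : deriv Real.arctan v = 1 / (1 + v ^ 2) := by
  rw [Real.deriv_arctan]

/-- `arctan'' v = -2v/(1+v²)²`. [folklore] -/
theorem iteratedDeriv_two_arctan (v : ℝ) :
    iteratedDeriv 2 Real.arctan v = -2 * v / (1 + v ^ 2) ^ 2 := by
  rw [iteratedDeriv_succ, iteratedDeriv_one, Real.deriv_arctan]
  have h1 : HasDerivAt (fun x : ℝ ↦ 1 + x ^ 2) (2 * v) v := by
    simpa using (hasDerivAt_pow 2 v).const_add 1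
  have hne : (1 : ℝ) + v ^ 2 ≠ 0 := by positivity
  have h2 : HasDerivAt (fun x : ℝ ↦ (1 + x ^ 2)⁻¹) (-(2 * v) / (1 + v ^ 2) ^ 2) v := h1.inv hne
  have heq : (fun x : ℝ ↦ 1 / (1 + x ^ 2)) = fun x ↦ (1 + x ^ 2)⁻¹ := by funext x; rw [one_div]
  rw [heq, h2.deriv]
  ring

/-- `arctan` as a time-independent `C²` function of two variables. [folklore] -/
theorem contDiff_uncurry_arctan : ContDiff ℝ 2 (Function.uncurry fun (_ : ℝ) (v : ℝ) ↦ Real.arctan v) :=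
  Real.contDiff_arctan.comp contDiff_snd

/-! ### The algebra of the drift -/

/-- **The Itô drift of `arctan(X/Y)`** (slope `w = X·I`, `I = 1/Y`, `Q = X² + Y²`): with drift
`X·(2I/Q) + I·(2X/Q - ρJ)` and diffusion coefficient `σI`, `σ² = κ`, the Itô drift
`b arctan'(w) + ½ (σI)² arctan''(w)` equals `(4 - κ) XY/Q² - ρ J Y/Q`. [cite: MillerSheffield2016, Thm. 2.4 (proof)] -/
theorem itoDrift_arctan_slope_eq {X Y σ κr ρ J : ℝ} (hY : 0 < Y) (hσ : σ ^ 2 = κr) :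
    (X * (2 * Y⁻¹ / (X ^ 2 + Y ^ 2)) + Y⁻¹ * (2 * X / (X ^ 2 + Y ^ 2) - ρ * J)) *
        (1 / (1 + (X * Y⁻¹) ^ 2)) +
      2⁻¹ * (σ * Y⁻¹) ^ 2 * (-2 * (X * Y⁻¹) / (1 + (X * Y⁻¹) ^ 2) ^ 2) =
      (4 - κr) * X * Y / (X ^ 2 + Y ^ 2) ^ 2 - ρ * J * Y / (X ^ 2 + Y ^ 2) := by
  have hY' : Y ≠ 0 := hY.ne'
  have hQ : X ^ 2 + Y ^ 2 ≠ 0 := by positivity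
  rw [← hσ]
  field_simp
  ring

/-- **The drift of `arctan((X + Z')/Y)`** (ratio `v = (X+Z')·I`, zero diffusion): with drift
`(X+Z')·(2I/Q) + I·(2X/Q - ρJ + (ρ+2)J)` and `J Z' = 1`, `b arctan'(v) = 2 J Y/Q`.
[cite: MillerSheffield2016, Thm. 2.4 (proof)] -/
theorem drift_arctan_ratio_eq {X Y Zp ρ J : ℝ} (hY : 0 < Y) (hJ : J * Zp = 1) :
    ((X + Zp) * (2 * Y⁻¹ / (X ^ 2 + Y ^ 2)) +
        Y⁻¹ * (2 * X / (X ^ 2 + Y ^ 2) - ρ * J + (ρ + 2) * J)) *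
      (1 / (1 + ((X + Zp) * Y⁻¹) ^ 2)) = 2 * J * Y / (X ^ 2 + Y ^ 2) := by
  have hY' : Y ≠ 0 := hY.ne'
  have hQ : X ^ 2 + Y ^ 2 ≠ 0 := by positivity
  have hP : (X + Zp) ^ 2 + Y ^ 2 ≠ 0 := by positivity
  have hZp : Zp ≠ 0 := by rintro rfl; simp at hJ
  have hJ' : J = Zp⁻¹ := eq_inv_of_mul_eq_one_left hJ
  subst hJ'
  field_simp
  ring

/-- **The total drift of `𝔥` vanishes**: with `2πχ = (4 - κ)λ`,
`(2λ/π)((4-κ)XY/Q² - ρJY/Q) + (λρ/π)(2JY/Q) - χ·4XY/Q² = 0`. [cite: MillerSheffield2016, Thm. 2.4 (proof)] -/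
theorem total_drift_eq_zero {lam chi κr ρ X Y J Q : ℝ} (hχ : 2 * π * chi = (4 - κr) * lam) :
    2 * lam / π * ((4 - κr) * X * Y / Q ^ 2 - ρ * J * Y / Q) + lam * ρ / π * (2 * J * Y / Q) -
      chi * (4 * X * Y / Q ^ 2) = 0 := by
  have hπ : (π : ℝ) ≠ 0 := Real.pi_ne_zero
  have hchi : chi = (4 - κr) * lam / (2 * π) := by
    rw [← hχ]; field_simp
  rw [hchi]
  field_simp
  ring

/-! ### The processes -/

section Defs

variable (κ : ℝ≥0) (ρ : ℝ) (W' J : ℝ≥0 → (ℝ≥0 → ℝ) → ℝ) (z : ℂ) (n : ℕ)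

/-- The slope `w = X · (1/Y)`. [cite: MillerSheffield2016, Thm. 2.4 (proof)] -/
def igW : ℝ≥0 → (ℝ≥0 → ℝ) → ℝ := fun t ω ↦ igX W' J z n t ω * igInvY W' J z n t ω

/-- The drift `X·𝟙2I/Q + I·𝟙(2X/Q - ρJ)` of the slope (product rule). [folklore] -/
def igWDrift : ℝ≥0 → (ℝ≥0 → ℝ) → ℝ := fun t ω ↦
  igX W' J z n t ω * igInvYRate W' J z n t ω + igInvY W' J z n t ω * igXDrift ρ W' J z n t ω

/-- The diffusion coefficient `𝟙(-√κ)·I` of the slope. [folklore] -/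
def igWDiffusion : ℝ≥0 → (ℝ≥0 → ℝ) → ℝ := fun t ω ↦ igDiffusion κ W' J z n t ω * igInvY W' J z n t ω

/-- `R = X + Z'` (`= re(g_t(z) - O_t)`, of finite variation). [cite: MillerSheffield2016, Thm. 2.4 (proof)] -/
def igR : ℝ≥0 → (ℝ≥0 → ℝ) → ℝ := fun t ω ↦ igX W' J z n t ω + igZp W' J z n t ω

/-- The drift `𝟙(2X/Q - ρJ) + 𝟙(ρ+2)J` of `R`. [folklore] -/
def igRDrift : ℝ≥0 → (ℝ≥0 → ℝ) → ℝ := fun t ω ↦ igXDrift ρ W' J z n t ω + igZpDrift ρ W' J z n t ω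

/-- The ratio `v = R · (1/Y) = (X + Z')/Y`. [cite: MillerSheffield2016, Thm. 2.4 (proof)] -/
def igV : ℝ≥0 → (ℝ≥0 → ℝ) → ℝ := fun t ω ↦ igR W' J z n t ω * igInvY W' J z n t ω

/-- The drift `R·𝟙2I/Q + I·b_R` of the ratio (product rule, no stochastic part). [folklore] -/
def igVDrift : ℝ≥0 → (ℝ≥0 → ℝ) → ℝ := fun t ω ↦
  igR W' J z n t ω * igInvYRate W' J z n t ω + igInvY W' J z n t ω * igRDrift ρ W' J z n t ω

/-- **The localised harmonic-function process `𝔥^{(n)}`**: the slope form of `𝔥_t(z)` evaluated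
along the localised processes,
`-λρ/2 + (2λ/π) arctan(w) + (λρ/π) arctan(v) - χ A` (equal to `𝔥_{t∧ρₙ}(z)` on good paths).
[cite: MillerSheffield2016, Thm. 1.1 and Thm. 2.4] -/
def igH : ℝ≥0 → (ℝ≥0 → ℝ) → ℝ := fun t ω ↦
  -(igLambda κ * ρ / 2) + 2 * igLambda κ / π * Real.arctan (igW W' J z n t ω) +
    igLambda κ * ρ / π * Real.arctan (igV W' J z n t ω) - igChi κ * igA W' J z n t ω

/-- The Itô integrand `σ_w · arctan'(w)` of `arctan(w)` (that of `𝔥^{(n)}` is `(2λ/π)` times it).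
[folklore] -/
def igHDiffusion : ℝ≥0 → (ℝ≥0 → ℝ) → ℝ := fun t ω ↦
  igWDiffusion κ W' J z n t ω * deriv Real.arctan (igW W' J z n t ω)

/-- The total drift of `𝔥^{(n)}` (vanishes a.e., `ae_timeIntegral_igHDrift_eq_zero`). [folklore] -/
def igHDrift : ℝ≥0 → (ℝ≥0 → ℝ) → ℝ := fun t ω ↦
  2 * igLambda κ / π * (igWDrift ρ W' J z n t ω * deriv Real.arctan (igW W' J z n t ω) +
      2⁻¹ * igWDiffusion κ W' J z n t ω ^ 2 * iteratedDeriv 2 Real.arctan (igW W' J z n t ω)) +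
    igLambda κ * ρ / π * (igVDrift ρ W' J z n t ω * deriv Real.arctan (igV W' J z n t ω)) -
    igChi κ * igARate W' J z n t ω

end Defs

variable {κ : ℝ≥0} {ρ : ℝ} {O W W' J : ℝ≥0 → (ℝ≥0 → ℝ) → ℝ} {z : ℂ} {n : ℕ}

/-! ### Bounds and progressivity -/

/-- The slope is progressively measurable. [folklore] -/
theorem isStronglyProgressive_igW (h : RegularPair κ ρ W W' J) (hz : 0 < z.im) (n : ℕ) :
    IsStronglyProgressive brownianFiltration (igW W' J z n) :=
  (isStronglyProgressive_igX h hz n).mul (isStronglyProgressive_igInvY h hz n)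

/-- The diffusion coefficient of the slope is progressively measurable. [folklore] -/
theorem isStronglyProgressive_igWDiffusion (h : RegularPair κ ρ W W' J) (hz : 0 < z.im) (n : ℕ) :
    IsStronglyProgressive brownianFiltration (igWDiffusion κ W' J z n) :=
  (isStronglyProgressive_igDiffusion h hz n).mul (isStronglyProgressive_igInvY h hz n)

/-- `|σ_w| ≤ √κ (n+2)/im z`. [folklore] -/
theorem abs_igWDiffusion_le (hz : 0 < z.im) (t : ℝ≥0) (ω : ℝ≥0 → ℝ) :
    |igWDiffusion κ W' J z n t ω| ≤ Real.sqrt κ * ((n + 2) / z.im) := by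
  rw [igWDiffusion, abs_mul]
  exact mul_le_mul (abs_igDiffusion_le t ω) (abs_igInvY_le hz t ω) (abs_nonneg _) (Real.sqrt_nonneg _)

/-- `R` is progressively measurable. [folklore] -/
theorem isStronglyProgressive_igR (h : RegularPair κ ρ W W' J) (hz : 0 < z.im) (n : ℕ) :
    IsStronglyProgressive brownianFiltration (igR W' J z n) :=
  (isStronglyProgressive_igX h hz n).add (isStronglyProgressive_igZp h hz n)

/-- `v` is progressively measurable. [folklore] -/
theorem isStronglyProgressive_igV (h : RegularPair κ ρ W W' J) (hz : 0 < z.im) (n : ℕ) :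
    IsStronglyProgressive brownianFiltration (igV W' J z n) :=
  (isStronglyProgressive_igR h hz n).mul (isStronglyProgressive_igInvY h hz n)

/-- The Itô integrand of `arctan(w)` is progressively measurable. [folklore] -/
theorem isStronglyProgressive_igHDiffusion (h : RegularPair κ ρ W W' J) (hz : 0 < z.im) (n : ℕ) :
    IsStronglyProgressive brownianFiltration (igHDiffusion κ W' J z n) := by
  have h1 : IsStronglyProgressive brownianFiltration fun t ω ↦ deriv Real.arctan (igW W' J z n t ω) :=
    IsStronglyProgressive.continuous_comp (isStronglyProgressive_igW h hz n)
      (Real.contDiff_arctan.continuous_deriv le_top)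
  exact (isStronglyProgressive_igWDiffusion h hz n).mul h1

/-- `|arctan'| ≤ 1`. [folklore] -/
theorem abs_deriv_arctan_le (v : ℝ) : |deriv Real.arctan v| ≤ 1 := by
  rw [deriv_arctan_apply, abs_of_pos (by positivity)]
  rw [div_le_one (by positivity)]
  nlinarith [sq_nonneg v]

/-- `0 ≤ λ`. [cite: MillerSheffield2016, Fig. 1.9 (§1)] -/
theorem igLambda_nonneg (κ : ℝ≥0) : 0 ≤ igLambda κ :=
  div_nonneg Real.pi_pos.le (Real.sqrt_nonneg _)

/-- **The Itô integrand of `arctan(w)` is bounded**: `|σ_w arctan'(w)| ≤ √κ (n+2)/im z`. [folklore] -/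
theorem abs_igHDiffusion_le (hz : 0 < z.im) (t : ℝ≥0) (ω : ℝ≥0 → ℝ) :
    |igHDiffusion κ W' J z n t ω| ≤ Real.sqrt κ * ((n + 2) / z.im) := by
  rw [igHDiffusion, abs_mul]
  calc |igWDiffusion κ W' J z n t ω| * |deriv Real.arctan (igW W' J z n t ω)|
      ≤ Real.sqrt κ * ((n + 2) / z.im) * 1 :=
        mul_le_mul (abs_igWDiffusion_le hz t ω) (abs_deriv_arctan_le _) (abs_nonneg _) (by positivity)
    _ = Real.sqrt κ * ((n + 2) / z.im) := mul_one _

/-! ### The slope and the ratio are Itô processes -/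

/-- A.s. `1/Y_t = 1/Y_0 + ∫₀ᵗ 𝟙 2I/Q` (good paths; `1/Y_0 = 1/im z`). [folklore] -/
theorem ae_igInvY_eq (hgood : ∀ᵐ ω ∂preWienerMeasure, GoodPath κ ρ O W W' J ω) (hz : 0 < z.im) (n : ℕ) :
    ∀ᵐ ω ∂preWienerMeasure, ∀ t : ℝ≥0, igInvY W' J z n t ω =
      igInvY W' J z n 0 ω + ∫ s in (0 : ℝ)..t, igInvYRate W' J z n s.toNNReal ω := by
  filter_upwards [hgood] with ω hω t
  rw [hω.igInvY_eq_integral hz t, hω.igInvY_eq_integral hz 0, timeIntegral_apply_zero, add_zero]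
  rfl

/-- **The slope `w = X·(1/Y)` is an Itô process** (progressive product rule): drift
`X·𝟙2I/Q + I·𝟙(2X/Q - ρJ)`, diffusion coefficient `𝟙(-√κ)·I`. [cite: RevuzYor1999, Ch. IV Prop. (3.1)] -/
theorem isItoProcess_igW (h : RegularPair κ ρ W W' J)
    (hgood : ∀ᵐ ω ∂preWienerMeasure, GoodPath κ ρ O W W' J ω) (hz : 0 < z.im) (n : ℕ) :
    IsItoProcess (igW W' J z n) (igWDrift ρ W' J z n) (igWDiffusion κ W' J z n)
      brownian brownianFiltration preWienerMeasure := by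
  have hσ := isStronglyProgressive_igDiffusion h hz n (κ := κ)
  have hXp := isStronglyProgressive_igX h hz n
  have hAp := isStronglyProgressive_igInvY h hz n
  obtain ⟨KX, hKX, hKXM, -⟩ := exists_isItoIntegral_of_abs_le (hσ.mul hXp)
    (C := Real.sqrt κ * igCx z n) fun t ω ↦ by
      rw [abs_mul]
      exact mul_le_mul (abs_igDiffusion_le t ω) (abs_igX_le hz t ω) (abs_nonneg _) (Real.sqrt_nonneg _)
  obtain ⟨K, hK, hKM, -⟩ := exists_isItoIntegral_of_abs_le (hσ.mul hAp)
    (C := Real.sqrt κ * ((n + 2) / z.im)) fun t ω ↦ by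
      rw [abs_mul]
      exact mul_le_mul (abs_igDiffusion_le t ω) (abs_igInvY_le hz t ω) (abs_nonneg _) (Real.sqrt_nonneg _)
  exact (isItoProcess_igX h hgood hz n).mul_timeIntegral_of_progressive hXp hσ hAp
    (ae_igInvY_eq hgood hz n) (ae_of_all _ fun ω t ↦ integrableOn_igInvYRate h hz n ω t) hKX hKXM hK hKM

/-- **`R = X + Z'` is an Itô process with zero diffusion coefficient**: a.s.
`R_t = re z + ∫₀ᵗ (𝟙(2X/Q - ρJ) + 𝟙(ρ+2)J) ds` (the stochastic terms `∓√κ B^{ρₙ}` of `X` and `Z'`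
cancel). [cite: MillerSheffield2016, Thm. 2.4 (proof)] -/
theorem isItoProcess_igR (h : RegularPair κ ρ W W' J)
    (hgood : ∀ᵐ ω ∂preWienerMeasure, GoodPath κ ρ O W W' J ω) (hz : 0 < z.im) (n : ℕ) :
    IsItoProcess (igR W' J z n) (igRDrift ρ W' J z n) (fun _ _ ↦ 0)
      brownian brownianFiltration preWienerMeasure := by
  refine ⟨?_, fun t ω ↦ 0 * brownian t ω, isItoIntegral_const_brownian 0, ?_⟩
  · filter_upwards [hgood] with ω hω t
    exact (hω.integrableOn_igXDrift h hz t).add (hω.integrableOn_igZpDrift t)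
  · filter_upwards [hgood] with ω hω t
    have h1 := hω.igX_eq_integral hz t (n := n)
    have h2 := hω.igZp_eq_integral h t (z := z) (n := n)
    have h10 := hω.igX_eq_integral hz 0 (n := n)
    have h20 := hω.igZp_eq_integral h 0 (z := z) (n := n)
    have hi1 : IntervalIntegrable (fun s : ℝ ↦ igXDrift ρ W' J z n s.toNNReal ω) volume 0 t :=
      (intervalIntegrable_iff_integrableOn_Icc_of_le t.coe_nonneg).2 (hω.integrableOn_igXDrift h hz t)
    have hi2 : IntervalIntegrable (fun s : ℝ ↦ igZpDrift ρ W' J z n s.toNNReal ω) volume 0 t :=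
      (intervalIntegrable_iff_integrableOn_Icc_of_le t.coe_nonneg).2 (hω.integrableOn_igZpDrift t)
    simp only [igR, igRDrift]
    rw [intervalIntegral.integral_add hi1 hi2, h1, h2, h10, h20, timeIntegral_apply_zero,
      timeIntegral_apply_zero]
    simp only [timeIntegral]
    ring

/-- **The ratio `v = (X + Z')·(1/Y)` is an Itô process of finite variation** (product rule with
zero diffusion coefficient): drift `R·𝟙2I/Q + I·b_R`, diffusion coefficient `0·I`.
[cite: RevuzYor1999, Ch. IV Prop. (3.1)] -/
theorem isItoProcess_igV (h : RegularPair κ ρ W W' J)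
    (hgood : ∀ᵐ ω ∂preWienerMeasure, GoodPath κ ρ O W W' J ω) (hz : 0 < z.im) (n : ℕ) :
    IsItoProcess (igV W' J z n) (igVDrift ρ W' J z n) (fun t ω ↦ 0 * igInvY W' J z n t ω)
      brownian brownianFiltration preWienerMeasure := by
  haveI := isProbabilityMeasure_preWienerMeasure'
  have hσ : IsStronglyProgressive brownianFiltration fun (_ : ℝ≥0) (_ : ℝ≥0 → ℝ) ↦ (0 : ℝ) :=
    isStronglyProgressive_const _ _
  have hRp := isStronglyProgressive_igR h hz n (ρ := ρ)
  have hAp := isStronglyProgressive_igInvY h hz n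
  have hzero : IsItoIntegral (fun (_ : ℝ≥0) (_ : ℝ≥0 → ℝ) ↦ (0 : ℝ)) brownian (fun _ _ ↦ (0 : ℝ))
      brownianFiltration preWienerMeasure := by
    have := isItoIntegral_const_brownian 0
    simpa only [zero_mul] using this
  have hM0 : Martingale (fun (_ : ℝ≥0) (_ : ℝ≥0 → ℝ) ↦ (0 : ℝ)) brownianFiltration preWienerMeasure :=
    martingale_const _ _ _
  have hKX : IsItoIntegral (fun t ω ↦ (0 : ℝ) * igR W' J z n t ω) brownian (fun _ _ ↦ (0 : ℝ))
      brownianFiltration preWienerMeasure := by simpa only [zero_mul] using hzero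
  have hK : IsItoIntegral (fun t ω ↦ (0 : ℝ) * igInvY W' J z n t ω) brownian (fun _ _ ↦ (0 : ℝ))
      brownianFiltration preWienerMeasure := by simpa only [zero_mul] using hzero
  exact (isItoProcess_igR h hgood hz n).mul_timeIntegral_of_progressive hRp hσ hAp
    (ae_igInvY_eq hgood hz n) (ae_of_all _ fun ω t ↦ integrableOn_igInvYRate h hz n ω t) hKX hM0 hK hM0

/-! ### Itô's formula for the two `arctan`s -/

/-- **The square-integrable Itô integral `K = ∫ (2λ/π) σ_w arctan'(w) dB`** of the bounded
progressive integrand of `𝔥^{(n)}` exists and is a martingale. [cite: RevuzYor1999, Ch. IV Thm (2.2)] -/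
theorem exists_isItoIntegral_igHDiffusion (h : RegularPair κ ρ W W' J) (hz : 0 < z.im) (n : ℕ) :
    ∃ K : ℝ≥0 → (ℝ≥0 → ℝ) → ℝ,
      IsItoIntegral (igHDiffusion κ W' J z n) brownian K brownianFiltration preWienerMeasure ∧
      Martingale K brownianFiltration preWienerMeasure := by
  obtain ⟨K, hK, hKM, -⟩ := exists_isItoIntegral_of_abs_le (isStronglyProgressive_igHDiffusion h hz n)
    fun t ω ↦ abs_igHDiffusion_le hz t ω
  exact ⟨K, hK, hKM⟩

/-- **Itô's formula for `arctan(w)`**: for any Itô integral `K` of `σ_w arctan'(w)`, almost surely,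
for all `t`, `arctan(w_t) = arctan(w_0) + ∫₀ᵗ (b_w arctan'(w) + ½σ_w² arctan''(w)) ds + K_t`, and the
drift is integrable on every `[0, t]`. [cite: RevuzYor1999, Ch. IV Thm (3.3) and Remark 1] -/
theorem ae_arctan_igW_eq (h : RegularPair κ ρ W W' J)
    (hgood : ∀ᵐ ω ∂preWienerMeasure, GoodPath κ ρ O W W' J ω) (hz : 0 < z.im) (n : ℕ)
    {K : ℝ≥0 → (ℝ≥0 → ℝ) → ℝ}
    (hK : IsItoIntegral (igHDiffusion κ W' J z n) brownian K brownianFiltration preWienerMeasure) :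
    ∀ᵐ ω ∂preWienerMeasure, ∀ t : ℝ≥0,
      (Real.arctan (igW W' J z n t ω) = Real.arctan (igW W' J z n 0 ω) +
        (∫ s in (0 : ℝ)..t,
          (igWDrift ρ W' J z n s.toNNReal ω * deriv Real.arctan (igW W' J z n s.toNNReal ω) +
            2⁻¹ * igWDiffusion κ W' J z n s.toNNReal ω ^ 2 *
              iteratedDeriv 2 Real.arctan (igW W' J z n s.toNNReal ω))) + K t ω) ∧
      IntegrableOn (fun s : ℝ ↦
          igWDrift ρ W' J z n s.toNNReal ω * deriv Real.arctan (igW W' J z n s.toNNReal ω) +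
            2⁻¹ * igWDiffusion κ W' J z n s.toNNReal ω ^ 2 *
              iteratedDeriv 2 Real.arctan (igW W' J z n s.toNNReal ω)) (Icc 0 t) := by
  have hw := isItoProcess_igW h hgood hz n (κ := κ)
  have hσw := isStronglyProgressive_igWDiffusion h hz n (κ := κ)
  have hwa : Adapted brownianFiltration (igW W' J z n) := fun t ↦
    ((isStronglyProgressive_igW h hz n).stronglyAdapted t).measurable
  have hK' : IsItoIntegral (fun t ω ↦ igWDiffusion κ W' J z n t ω *
      deriv ((fun (_ : ℝ) (v : ℝ) ↦ Real.arctan v) t) (igW W' J z n t ω)) brownian K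
      brownianFiltration preWienerMeasure := hK
  have hito := ito_formula_itoProcess_ae_holds (fun (_ : ℝ) (v : ℝ) ↦ Real.arctan v)
    contDiff_uncurry_arctan hwa hσw hw hK'
  have hint := hw.ae_integrableOn_itoDrift contDiff_uncurry_arctan hσw
  filter_upwards [hito, hint] with ω hω hiω t
  have h1 := hω t
  have h2 := hiω t
  simp only [deriv_const, zero_add] at h1 h2
  exact ⟨h1, h2⟩

/-- **Itô's formula for `arctan(v)`** (no stochastic term): almost surely, for all `t`,
`arctan(v_t) = arctan(v_0) + ∫₀ᵗ b_v arctan'(v) ds`, and the drift is integrable on every `[0, t]`.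
[cite: RevuzYor1999, Ch. IV Thm (3.3) and Remark 1] -/
theorem ae_arctan_igV_eq (h : RegularPair κ ρ W W' J)
    (hgood : ∀ᵐ ω ∂preWienerMeasure, GoodPath κ ρ O W W' J ω) (hz : 0 < z.im) (n : ℕ) :
    ∀ᵐ ω ∂preWienerMeasure, ∀ t : ℝ≥0,
      (Real.arctan (igV W' J z n t ω) = Real.arctan (igV W' J z n 0 ω) +
        ∫ s in (0 : ℝ)..t,
          igVDrift ρ W' J z n s.toNNReal ω * deriv Real.arctan (igV W' J z n s.toNNReal ω)) ∧
      IntegrableOn (fun s : ℝ ↦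
          igVDrift ρ W' J z n s.toNNReal ω * deriv Real.arctan (igV W' J z n s.toNNReal ω)) (Icc 0 t) := by
  have hv := isItoProcess_igV h hgood hz n (κ := κ)
  have hσv : IsStronglyProgressive brownianFiltration fun t ω ↦ (0 : ℝ) * igInvY W' J z n t ω :=
    (isStronglyProgressive_const _ _).mul (isStronglyProgressive_igInvY h hz n)
  have hva : Adapted brownianFiltration (igV W' J z n) := fun t ↦
    ((isStronglyProgressive_igV h hz n).stronglyAdapted t).measurable
  have hzero : IsItoIntegral (fun (_ : ℝ≥0) (_ : ℝ≥0 → ℝ) ↦ (0 : ℝ)) brownian (fun _ _ ↦ (0 : ℝ))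
      brownianFiltration preWienerMeasure := by
    simpa only [zero_mul] using isItoIntegral_const_brownian 0
  have hK' : IsItoIntegral (fun t ω ↦ 0 * igInvY W' J z n t ω *
      deriv ((fun (_ : ℝ) (v : ℝ) ↦ Real.arctan v) t) (igV W' J z n t ω)) brownian (fun _ _ ↦ (0 : ℝ))
      brownianFiltration preWienerMeasure := by
    have heq : (fun t ω ↦ 0 * igInvY W' J z n t ω *
        deriv ((fun (_ : ℝ) (v : ℝ) ↦ Real.arctan v) t) (igV W' J z n t ω)) = fun _ _ ↦ (0 : ℝ) := by
      funext t ω; ring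
    rw [heq]; exact hzero
  have hito := ito_formula_itoProcess_ae_holds (fun (_ : ℝ) (v : ℝ) ↦ Real.arctan v)
    contDiff_uncurry_arctan hva hσv hv hK'
  have hint := hv.ae_integrableOn_itoDrift contDiff_uncurry_arctan hσv
  filter_upwards [hito, hint] with ω hω hiω t
  have h1 := hω t
  have h2 := hiω t
  simp only [deriv_const, zero_add, zero_mul, ne_eq, OfNat.ofNat_ne_zero, not_false_eq_true,
    zero_pow, mul_zero, add_zero] at h1 h2
  exact ⟨h1, h2⟩

/-! ### The drift vanishes almost everywhere in time -/

/-- **After `ρₙ` every coefficient vanishes**, hence so does the drift of `𝔥^{(n)}`. [folklore] -/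
theorem igHDrift_eq_zero_of_not_le {s : ℝ≥0} {ω : ℝ≥0 → ℝ}
    (hs : ¬ (s : WithTop ℝ≥0) ≤ igLocTime W' J z n ω) : igHDrift κ ρ W' J z n s ω = 0 := by
  simp only [igHDrift, igWDrift, igVDrift, igWDiffusion, igRDrift, igXDrift, igInvYRate, igZpDrift,
    igDiffusion, igARate, trunc_of_not_le hs]
  ring

/-- **Up to `ρₙ`, off the collision set, the drift of `𝔥^{(n)}` vanishes** (good path, `κ > 0`):
at a time `s ≤ ρₙ` with `Z'_s > 0` the coefficients are the honest ones, `J_s Z'_s = 1`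
(`RegularPair.eq_inv`), and the algebra of `itoDrift_arctan_slope_eq`, `drift_arctan_ratio_eq`,
`total_drift_eq_zero` with `2πχ = (4-κ)λ` closes. [cite: MillerSheffield2016, Thm. 2.4 (proof)] -/
theorem igHDrift_eq_zero_of_le {ω : ℝ≥0 → ℝ} (hω : GoodPath κ ρ O W W' J ω) (h : RegularPair κ ρ W W' J)
    (hz : 0 < z.im) (hκ : 0 < κ) {s : ℝ≥0} (hs : (s : WithTop ℝ≥0) ≤ igLocTime W' J z n ω)
    (hpos : 0 < W' s ω + 2 * timeIntegral J s ω) : igHDrift κ ρ W' J z n s ω = 0 := by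
  have hY : 0 < igY W' J z n s ω := igY_pos hz s ω
  have hZp : igZp W' J z n s ω = W' s ω + 2 * timeIntegral J s ω := hω.igZp_eq_of_le h hs
  have hJZ : J s ω * igZp W' J z n s ω = 1 := by
    rw [hZp, h.eq_inv s ω, inv_mul_cancel₀ hpos.ne']
  have hσ : (-Real.sqrt κ) ^ 2 = (κ : ℝ) := by rw [neg_sq, Real.sq_sqrt κ.coe_nonneg]
  have hχ : 2 * π * igChi κ = (4 - (κ : ℝ)) * igLambda κ := two_pi_mul_igChi hκ
  have hA := itoDrift_arctan_slope_eq (X := igX W' J z n s ω) (ρ := ρ) (J := J s ω) hY hσ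
  have hB := drift_arctan_ratio_eq (X := igX W' J z n s ω) (ρ := ρ) hY hJZ
  have hT := total_drift_eq_zero (X := igX W' J z n s ω) (Y := igY W' J z n s ω) (ρ := ρ)
    (J := J s ω) (Q := igX W' J z n s ω ^ 2 + igY W' J z n s ω ^ 2) hχ
  simp only [igHDrift, igWDrift, igVDrift, igWDiffusion, igW, igV, igR, igRDrift, igXDrift,
    igInvYRate, igZpDrift, igDiffusion, igARate, igInvY, igQ, trunc_of_le hs, deriv_arctan_apply,
    iteratedDeriv_two_arctan] at hA hB hT ⊢
  linear_combination (2 * igLambda κ / π) * hA + (igLambda κ * ρ / π) * hB + hT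

/-- **A.s. the time integral of the drift of `𝔥^{(n)}` vanishes at all times**: along a good path the
drift vanishes at every time after `ρₙ` and at Lebesgue-a.e. time before (the collision set
`{Z' = 0}` is null, `GoodPath.ae_pos`). [cite: MillerSheffield2016, Thm. 2.4 (proof)] -/
theorem ae_integral_igHDrift_eq_zero (h : RegularPair κ ρ W W' J)
    (hgood : ∀ᵐ ω ∂preWienerMeasure, GoodPath κ ρ O W W' J ω) (hz : 0 < z.im) (hκ : 0 < κ) (n : ℕ) :
    ∀ᵐ ω ∂preWienerMeasure, ∀ t : ℝ≥0, ∫ s in (0 : ℝ)..t, igHDrift κ ρ W' J z n s.toNNReal ω = 0 := by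
  filter_upwards [hgood] with ω hω t
  have hae : ∀ᵐ s ∂(volume.restrict (Ioi (0 : ℝ))), igHDrift κ ρ W' J z n s.toNNReal ω = 0 := by
    filter_upwards [hω.ae_pos] with s hs
    by_cases hle : ((s.toNNReal : ℝ≥0) : WithTop ℝ≥0) ≤ igLocTime W' J z n ω
    · exact igHDrift_eq_zero_of_le hω h hz hκ hle hs
    · exact igHDrift_eq_zero_of_not_le hle
  rw [intervalIntegral.integral_of_le t.coe_nonneg]
  refine integral_eq_zero_of_ae ?_
  exact ae_restrict_of_ae_restrict_of_subset Ioc_subset_Ioi_self hae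

/-! ### The semimartingale decomposition of `𝔥^{(n)}` -/

/-- `igA` read at real time is the interval integral of its rate. [folklore] -/
theorem igA_eq_integral (t : ℝ≥0) (ω : ℝ≥0 → ℝ) :
    igA W' J z n t ω = ∫ s in (0 : ℝ)..t, igARate W' J z n s.toNNReal ω := rfl

/-- **`𝔥^{(n)}_t = 𝔥^{(n)}_0 + (2λ/π) K_t` almost surely, for all `t`** (`κ > 0`), for any Itô integral
`K` of `σ_w arctan'(w)`: Itô's formula for the two `arctan`s, `A = ∫ 𝟙 4XY/Q²`, and the vanishing
of the total drift (`ae_integral_igHDrift_eq_zero`). This is Miller–Sheffield's "Itô's formula"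
step for the forward direction of Thm. 2.4, localised at `ρₙ`. [cite: MillerSheffield2016, Thm. 2.4 (proof)] -/
theorem ae_igH_eq (h : RegularPair κ ρ W W' J)
    (hgood : ∀ᵐ ω ∂preWienerMeasure, GoodPath κ ρ O W W' J ω) (hz : 0 < z.im) (hκ : 0 < κ) (n : ℕ)
    {K : ℝ≥0 → (ℝ≥0 → ℝ) → ℝ}
    (hK : IsItoIntegral (igHDiffusion κ W' J z n) brownian K brownianFiltration preWienerMeasure) :
    ∀ᵐ ω ∂preWienerMeasure, ∀ t : ℝ≥0,
      igH κ ρ W' J z n t ω = igH κ ρ W' J z n 0 ω + 2 * igLambda κ / π * K t ω := by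
  filter_upwards [ae_arctan_igW_eq h hgood hz n hK, ae_arctan_igV_eq h hgood hz n (κ := κ),
    ae_integral_igHDrift_eq_zero h hgood hz hκ n] with ω hW hV hD t
  obtain ⟨hW1, hW2⟩ := hW t
  obtain ⟨hV1, hV2⟩ := hV t
  have hD1 := hD t
  have hA3 : IntegrableOn (fun s : ℝ ↦ igARate W' J z n s.toNNReal ω) (Icc 0 t) :=
    integrableOn_igARate h hz n ω t
  -- interval integrability of the three pieces
  have iW := (intervalIntegrable_iff_integrableOn_Icc_of_le t.coe_nonneg).2 hW2
  have iV := (intervalIntegrable_iff_integrableOn_Icc_of_le t.coe_nonneg).2 hV2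
  have iA := (intervalIntegrable_iff_integrableOn_Icc_of_le t.coe_nonneg).2 hA3
  -- the total drift integral is the combination of the three
  have hsplit : (∫ s in (0 : ℝ)..t, igHDrift κ ρ W' J z n s.toNNReal ω) =
      2 * igLambda κ / π * (∫ s in (0 : ℝ)..t,
          (igWDrift ρ W' J z n s.toNNReal ω * deriv Real.arctan (igW W' J z n s.toNNReal ω) +
            2⁻¹ * igWDiffusion κ W' J z n s.toNNReal ω ^ 2 *
              iteratedDeriv 2 Real.arctan (igW W' J z n s.toNNReal ω))) +
        igLambda κ * ρ / π * (∫ s in (0 : ℝ)..t,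
          igVDrift ρ W' J z n s.toNNReal ω * deriv Real.arctan (igV W' J z n s.toNNReal ω)) -
        igChi κ * ∫ s in (0 : ℝ)..t, igARate W' J z n s.toNNReal ω := by
    rw [← intervalIntegral.integral_const_mul, ← intervalIntegral.integral_const_mul,
      ← intervalIntegral.integral_const_mul,
      ← intervalIntegral.integral_add (iW.const_mul _) (iV.const_mul _),
      ← intervalIntegral.integral_sub ((iW.const_mul _).add (iV.const_mul _)) (iA.const_mul _)]
    rfl
  have hA0 : igA W' J z n 0 ω = 0 := timeIntegral_apply_zero _ _
  simp only [igH]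
  rw [igA_eq_integral t ω, hA0, hW1, hV1]
  rw [hsplit] at hD1
  linear_combination hD1

/-- **`𝔥^{(n)} - 𝔥^{(n)}_0` is indistinguishable from a square-integrable martingale**: there is a
martingale `K = ∫ σ_w arctan'(w) dB` with a.s. `𝔥^{(n)}_t = 𝔥^{(n)}_0 + (2λ/π) K_t` for all `t`
(`κ > 0`). [cite: MillerSheffield2016, Thm. 2.4 (forward direction)] -/
theorem exists_martingale_igH (h : RegularPair κ ρ W W' J)
    (hgood : ∀ᵐ ω ∂preWienerMeasure, GoodPath κ ρ O W W' J ω) (hz : 0 < z.im) (hκ : 0 < κ) (n : ℕ) :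
    ∃ K : ℝ≥0 → (ℝ≥0 → ℝ) → ℝ,
      IsItoIntegral (igHDiffusion κ W' J z n) brownian K brownianFiltration preWienerMeasure ∧
      Martingale K brownianFiltration preWienerMeasure ∧
      ∀ᵐ ω ∂preWienerMeasure, ∀ t : ℝ≥0,
        igH κ ρ W' J z n t ω = igH κ ρ W' J z n 0 ω + 2 * igLambda κ / π * K t ω := by
  obtain ⟨K, hK, hKM⟩ := exists_isItoIntegral_igHDiffusion h hz n (κ := κ)
  exact ⟨K, hK, hKM, ae_igH_eq h hgood hz hκ n hK⟩

end SLEKappaRho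

end Literature.Probability.RandomPlanarGeometry
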